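import Mathlib
import Summits.CriticalPhenomena.PercolationContinuityZ3.Theorems.PercNearOneGluingNearOneGluingAttachRescueNegCorr
import Summits.CriticalPhenomena.PercolationContinuityZ3.Theorems.PercNearOneGluingAdditiveGluingBhkSetsAux
import Literature.Probability.Percolation.SharpnessDCTProofs
import Literature.Probability.LatticeModels.ProdBernoulliIndependence
import Literature.Probability.Percolation.Crossings
import Literature.Probability.Percolation.PercolationEvents
import HarnessLib

/-!
# Crux `PercNearOneGluing.NearOneGluing` (stmt-CriticalPhenomena-4574), line `SketchR2I5` — stub `stub_attachSetRescueNegCorr`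

Helper file for the crux (lead prover-line-stmt-CriticalPhenomena-4574-c5): the SET version of
the negative-correlation lemma `stub_attachRescueNegCorr` (tool for the `h`-term of the `|A| = 3`
kernel of RESCUE).  Proves exactly the registered stub signature; lands with
`--supports stmt-CriticalPhenomena-4574`.

## Content

Finite weighted graph on `Fin n`, `μ = prodBernoulli w` on bond configurations
`ω : Set (Sym2 (Fin n))`, source `o`, target `b`, an outsider `x`, a relay SET `A : Finset (Fin n)`
and a vertex set `S`.  Attachment event of the set
`F_A = {∃ a ∈ A, o ↔ a inside insert a S}` (increasing) and rescue event
`h = {∀ a ∈ A, a ↮ b} ∩ {x ↔ b}` ("the set is dead but the outsider is alive").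
THEOREM (`stub_attachSetRescueNegCorr`): **`μ(F_A ∩ h) ≤ μ(F_A) · μ(h)`.**

Proof (the proof of `stub_attachRescueNegCorr` transported to the hub-augmented graph of the file
`PercNearOneGluingAdditiveGluingBhkSetsAux`).  On `Option (Fin n)` (hub `none`, old vertex `v` as
`some v`) put the augmented weights `hubW⟦A, w⟧` (old pairs keep their weight, the hub pairs
`s(none, some a)`, `a ∈ A`, get weight `1`, all other new pairs weight `0`); the law of the lift
`hubLift⟦A, η⟧ = Sym2.map some '' η ∪ {hub pairs}` under `μ` is `prodBernoulli hubW⟦A, w⟧`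
(`bhkHub_integral`), so `μ'(E) = μ(lift ⁻¹' E)` for every event `E` of the augmented graph
(`attachSet_measureReal_hub`).  van den Berg–Häggström–Kahn (2006), Thm. 1.5 on the augmented graph
for the pair `(s, t) = (some x, none)` (`attachRescueNegCorr_twoCluster`) with the increasing event
`Q' = {∃ a ∈ A, s(none, some a) open ∧ some o ↔ some a inside some '' (insert a S)}` (determined by,
and increasing in, the open edge cluster of the hub: `attachSet_hubEvent_mono_openEdgeCluster`) pulls
back to `μ(h) · μ(D ∩ F_Aᶜ) ≤ μ(D) · μ(h ∩ F_Aᶜ)` with `D = {∀ a ∈ A, x ↮ a} ⊇ h`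
(pull-backs: `{some x ↮ none} ↦ D`, `{none ↮ some b} ↦ {∀ a ∈ A, a ↮ b}`,
`{some x ↔ some b} ↦ {x ↔ b}` on `D`, `Q' ↦ F_A`).  Harris for the increasing `F_A` and the
decreasing `D` gives `μ(F_A ∩ D) ≤ μ(F_A) μ(D)`, and the bookkeeping of `stub_attachRescueNegCorr`
finishes: `μ(D) μ(F_A ∩ h) ≤ μ(h) μ(F_A ∩ D) ≤ μ(D) μ(F_A) μ(h)` (if `μ(D) = 0` then
`μ(F_A ∩ h) ≤ μ(h) ≤ μ(D) = 0`).
-/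

namespace Summit.CriticalPhenomena.PercolationContinuityZ3.Theorems

open MeasureTheory Set Literature.Probability.LatticeModels Literature.Probability.Percolation
open scoped Classical BigOperators

section AttachSetRescueNegCorr

variable {V : Type*}

/-- `hubLift⟦A, η⟧`, the hub lift of a configuration `η` on `V` to the augmented vertex type
`Option V` (file-local notation for the tree term `Sym2.map some '' η ∪ {e | ∃ a ∈ A, e = s(none, some a)}`,
copied from `PercNearOneGluingAdditiveGluingBhkSetsAux`). -/
local notation3 (prettyPrint := false) "hubLift⟦" A ", " η "⟧" =>
  (Sym2.map some '' η ∪ {e | ∃ a ∈ A, e = s(none, some a)})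

/-- `hubW⟦A, w⟧`, the augmented weights (file-local notation for the tree term
`Function.extend (Sym2.map some) w (fun e => if ∃ a ∈ A, e = s(none, some a) then 1 else 0)`, copied
from `PercNearOneGluingAdditiveGluingBhkSetsAux`). -/
local notation3 (prettyPrint := false) "hubW⟦" A ", " w "⟧" =>
  (Function.extend (Sym2.map some) w fun e =>
    @ite unitInterval (∃ a ∈ A, e = s(none, some a)) (Classical.dec _) 1 0)

/-! ### The attachment event of the augmented graph -/

/-- Two joined vertices have the same open edge cluster. [folklore] -/
theorem attachSet_openEdgeCluster_eq_of_reachable {ω : BondConfig V} {u v : V}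
    (h : (openGraph ω).Reachable u v) : openEdgeCluster ω u = openEdgeCluster ω v := by
  ext e
  simp only [mem_openEdgeCluster_iff]
  exact and_congr_right fun _ => and_congr_right fun _ =>
    forall₂_congr fun z _ => ⟨fun hz => h.symm.trans hz, fun hz => h.trans hz⟩

/-- **The attachment event of the augmented graph is increasing in the open edge cluster of the
hub.**  The event is "for some `a ∈ A` the hub pair `s(none, some a)` is open and
`some o ↔ some a` inside `some '' (insert a S)`": the hub pair lies in `C_none`, so it stays open, and
`C_none = C_{some a}` in both configurations, so the restricted connection persists by
`maxattTwo_openConnIn_mono_openEdgeCluster`. -/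
theorem attachSet_hubEvent_mono_openEdgeCluster (A : Finset V) (S : Set V) (o : V) :
    ∀ ω ω' : BondConfig (Option V),
      ω ∈ {ω : BondConfig (Option V) | ∃ a ∈ A, s(none, some a) ∈ ω ∧
          ω ∈ openConnIn (some '' insert a S) (some o) (some a)} →
      openEdgeCluster ω none ⊆ openEdgeCluster ω' none →
      ω' ∈ {ω : BondConfig (Option V) | ∃ a ∈ A, s(none, some a) ∈ ω ∧
          ω ∈ openConnIn (some '' insert a S) (some o) (some a)} := by
  rintro ω ω' ⟨a, ha, he, hconn⟩ hsub
  have hna : (none : Option V) ≠ some a := (Option.some_ne_none a).symm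
  have hadj : (openGraph ω).Adj none (some a) := (openGraph_adj ω _ _).2 ⟨he, hna⟩
  have hmem : s(none, some a) ∈ openEdgeCluster ω none := by
    refine (mem_openEdgeCluster_iff ω none _).2 ⟨he, ?_, ?_⟩
    · rw [Sym2.mk_isDiag_iff]
      exact hna
    · intro z hz
      rcases Sym2.mem_iff.1 hz with rfl | rfl
      · exact SimpleGraph.Reachable.refl _
      · exact hadj.reachable
  have he' : s(none, some a) ∈ ω' := openEdgeCluster_subset ω' none (hsub hmem)
  have hadj' : (openGraph ω').Adj none (some a) := (openGraph_adj ω' _ _).2 ⟨he', hna⟩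
  refine ⟨a, ha, he', maxattTwo_openConnIn_mono_openEdgeCluster _ (some o) (some a) ω ω' hconn ?_⟩
  rw [← attachSet_openEdgeCluster_eq_of_reachable hadj.reachable,
    ← attachSet_openEdgeCluster_eq_of_reachable hadj'.reachable]
  exact hsub

/-! ### Pull-backs of the events of the augmented graph under the lift -/

/-- **Pull-back of a restricted connection between old vertices**: `some u ↔ some v` inside
`some '' T` in the lift iff `u ↔ v` inside `T` in the configuration (transport of open paths along
`some` and back along `Option.getD · u`). -/
theorem attachSet_lift_mem_openConnIn {A : Finset V} {η : BondConfig V} {T : Set V} {u v : V} :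
    hubLift⟦A, η⟧ ∈ openConnIn (some '' T) (some u) (some v) ↔ η ∈ openConnIn T u v := by
  rw [DCT16.mem_openConnIn_iff_pathIn, DCT16.mem_openConnIn_iff_pathIn]
  constructor
  · intro h
    have hT : ∀ z ∈ some '' T, (fun z : Option V => z.getD u) z ∈ T := by
      rintro _ ⟨c, hc, rfl⟩
      simpa only [Option.getD_some] using hc
    have hadj : ∀ z z', z ∈ some '' T → z' ∈ some '' T → (openGraph hubLift⟦A, η⟧).Adj z z' →
        (openGraph η).Adj ((fun z : Option V => z.getD u) z)
          ((fun z : Option V => z.getD u) z') := by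
      rintro _ _ ⟨c, hc, rfl⟩ ⟨c', hc', rfl⟩ hzz'
      simpa only [Option.getD_some] using bhkHub_adj_some_some.1 hzz'
    simpa only [Option.getD_some] using DCT16.pathIn_map (fun z : Option V => z.getD u) hT hadj h
  · intro h
    exact DCT16.pathIn_map (G' := openGraph hubLift⟦A, η⟧) some
      (fun c hc => Set.mem_image_of_mem some hc) (fun c c' _ _ hcc' => bhkHub_adj_some_some.2 hcc') h

/-- **Pull-back of the attachment event of the augmented graph**: it is the attachment event of the
set, `F_A = {∃ a ∈ A, o ↔ a inside insert a S}`. -/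
theorem attachSet_lift_mem_hubEvent {A : Finset V} {η : BondConfig V} {S : Set V} {o : V} :
    hubLift⟦A, η⟧ ∈ {ω : BondConfig (Option V) | ∃ a ∈ A, s(none, some a) ∈ ω ∧
        ω ∈ openConnIn (some '' insert a S) (some o) (some a)} ↔
      η ∈ {η : BondConfig V | ∃ a ∈ A, η ∈ openConnIn (insert a S) o a} := by
  constructor
  · rintro ⟨a, ha, -, h⟩
    exact ⟨a, ha, attachSet_lift_mem_openConnIn.1 h⟩
  · rintro ⟨a, ha, h⟩
    exact ⟨a, ha, bhkHub_hub_mem_lift.2 ha, attachSet_lift_mem_openConnIn.2 h⟩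

/-- **Pull-back of `{some x ↔ none}`**: `x ↔ a` for some `a ∈ A`. -/
theorem attachSet_lift_mem_openConn_some_none {A : Finset V} {η : BondConfig V} {x : V} :
    hubLift⟦A, η⟧ ∈ (openConn (some x) none : Set (BondConfig (Option V))) ↔
      ∃ a ∈ A, η ∈ (openConn x a : Set (BondConfig V)) := by
  change (openGraph hubLift⟦A, η⟧).Reachable (some x) none ↔ ∃ a ∈ A, (openGraph η).Reachable x a
  rw [SimpleGraph.reachable_comm, bhkHub_reachable_none_some]
  exact exists_congr fun a => and_congr_right fun _ => SimpleGraph.reachable_comm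

/-- **Pull-back of `{none ↔ some y}`**: `a ↔ y` for some `a ∈ A`. -/
theorem attachSet_lift_mem_openConn_none_some {A : Finset V} {η : BondConfig V} {y : V} :
    hubLift⟦A, η⟧ ∈ (openConn none (some y) : Set (BondConfig (Option V))) ↔
      ∃ a ∈ A, η ∈ (openConn a y : Set (BondConfig V)) :=
  bhkHub_reachable_none_some

/-- **Pull-back of `{some x ↔ some y}` off the attachment of `x`**: `x ↔ y`. -/
theorem attachSet_lift_mem_openConn_some_some {A : Finset V} {η : BondConfig V} {x y : V}
    (hx : ∀ a ∈ A, η ∉ (openConn x a : Set (BondConfig V))) :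
    hubLift⟦A, η⟧ ∈ (openConn (some x) (some y) : Set (BondConfig (Option V))) ↔
      η ∈ (openConn x y : Set (BondConfig V)) :=
  bhkHub_reachable_some_some fun ⟨a, ha, h⟩ => hx a ha (SimpleGraph.Reachable.symm h)

/-- **Pull-back of `D' = {some x ↮ none}`**: `D = {∀ a ∈ A, x ↮ a}`. -/
theorem attachSet_pull_D {A : Finset V} {x : V} (η : BondConfig V) :
    hubLift⟦A, η⟧ ∈ (openConn (some x) none : Set (BondConfig (Option V)))ᶜ ↔
      η ∈ {ω : BondConfig V | ∀ a ∈ A, ω ∉ (openConn x a : Set (BondConfig V))} := by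
  rw [Set.mem_compl_iff, attachSet_lift_mem_openConn_some_none, Set.mem_setOf_eq, not_exists]
  exact forall_congr' fun a => not_and

/-- **Pull-back of `D' ∩ ({none ↮ some b} ∩ {some x ↔ some b})`**: the rescue event
`h = {∀ a ∈ A, a ↮ b} ∩ {x ↔ b}` (note `h ⊆ D`: if `x ↔ a` and `x ↔ b` then `a ↔ b`). -/
theorem attachSet_pull_h {A : Finset V} {x b : V} (η : BondConfig V) :
    hubLift⟦A, η⟧ ∈ (openConn (some x) none : Set (BondConfig (Option V)))ᶜ ∩
        ((openConn none (some b))ᶜ ∩ openConn (some x) (some b)) ↔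
      η ∈ {ω : BondConfig V | ∀ a ∈ A, ω ∉ (openConn a b : Set (BondConfig V))} ∩ openConn x b := by
  rw [Set.mem_inter_iff, Set.mem_inter_iff, Set.mem_inter_iff, attachSet_pull_D, Set.mem_compl_iff,
    attachSet_lift_mem_openConn_none_some, Set.mem_setOf_eq, Set.mem_setOf_eq, not_exists]
  constructor
  · rintro ⟨h0, h1, h2⟩
    exact ⟨fun a ha h => h1 a ⟨ha, h⟩, (attachSet_lift_mem_openConn_some_some h0).1 h2⟩
  · rintro ⟨h1, h2⟩
    have h0 : ∀ a ∈ A, η ∉ (openConn x a : Set (BondConfig V)) := fun a ha h =>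
      h1 a ha (SimpleGraph.Reachable.trans (SimpleGraph.Reachable.symm h) h2)
    exact ⟨h0, fun a h => h1 a h.1 h.2, (attachSet_lift_mem_openConn_some_some h0).2 h2⟩

/-- **Pull-back of `D' ∩ Q'ᶜ`**: `D ∩ F_Aᶜ`. -/
theorem attachSet_pull_DQ {A : Finset V} {S : Set V} {o x : V} (η : BondConfig V) :
    hubLift⟦A, η⟧ ∈ (openConn (some x) none : Set (BondConfig (Option V)))ᶜ ∩
        {ω : BondConfig (Option V) | ∃ a ∈ A, s(none, some a) ∈ ω ∧
          ω ∈ openConnIn (some '' insert a S) (some o) (some a)}ᶜ ↔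
      η ∈ {ω : BondConfig V | ∀ a ∈ A, ω ∉ (openConn x a : Set (BondConfig V))} ∩
        {ω : BondConfig V | ∃ a ∈ A, ω ∈ openConnIn (insert a S) o a}ᶜ :=
  and_congr (attachSet_pull_D η) (not_congr attachSet_lift_mem_hubEvent)

/-- **Pull-back of `D' ∩ ({none ↮ some b} ∩ {some x ↔ some b} ∩ Q'ᶜ)`**: `h ∩ F_Aᶜ`. -/
theorem attachSet_pull_hQ {A : Finset V} {S : Set V} {o x b : V} (η : BondConfig V) :
    hubLift⟦A, η⟧ ∈ (openConn (some x) none : Set (BondConfig (Option V)))ᶜ ∩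
        ((openConn none (some b))ᶜ ∩ openConn (some x) (some b) ∩
          {ω : BondConfig (Option V) | ∃ a ∈ A, s(none, some a) ∈ ω ∧
            ω ∈ openConnIn (some '' insert a S) (some o) (some a)}ᶜ) ↔
      η ∈ {ω : BondConfig V | ∀ a ∈ A, ω ∉ (openConn a b : Set (BondConfig V))} ∩ openConn x b ∩
        {ω : BondConfig V | ∃ a ∈ A, ω ∈ openConnIn (insert a S) o a}ᶜ := by
  rw [← Set.inter_assoc]
  exact and_congr (attachSet_pull_h η) (not_congr attachSet_lift_mem_hubEvent)

/-! ### The law of the lift on events -/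

/-- **The law of the lift on events**: if `E` pulls back to `E₀` under the lift then
`μ'(E) = μ(E₀)` (`bhkHub_integral` for the indicator of `E`). -/
theorem attachSet_measureReal_hub [Fintype V] (A : Finset V) (w : Sym2 V → unitInterval)
    {E : Set (BondConfig (Option V))} {E₀ : Set (BondConfig V)}
    (hE : ∀ η, hubLift⟦A, η⟧ ∈ E ↔ η ∈ E₀) :
    (prodBernoulli hubW⟦A, w⟧).real E = (prodBernoulli w).real E₀ := by
  rw [← integral_indicator_one (MeasurableSet.of_discrete (s := E)), bhkHub_integral A w,
    ← integral_indicator_one (MeasurableSet.of_discrete (s := E₀))]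
  refine integral_congr_ae (Filter.Eventually.of_forall fun η => ?_)
  show E.indicator 1 hubLift⟦A, η⟧ = E₀.indicator 1 η
  by_cases hη : η ∈ E₀
  · rw [indicator_of_mem ((hE η).2 hη), indicator_of_mem hη]
    rfl
  · rw [indicator_of_notMem (fun h => hη ((hE η).1 h)), indicator_of_notMem hη]

/-! ### The stub -/

/-- **Attachment of a relay SET is nonpositively correlated with "the set is dead but the outsider
is alive".**  For the attachment event `F_A = {∃ a ∈ A, o ↔ a inside insert a S}` (any vertex set
`S`) and the rescue event `h = {∀ a ∈ A, a ↮ b} ∩ {x ↔ b}`: `μ(F_A ∩ h) ≤ μ(F_A) · μ(h)`.  From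
van den Berg–Häggström–Kahn (2006) Thm. 1.5 on the hub-augmented graph for the pair
`(some x, none)` (`attachRescueNegCorr_twoCluster`, `bhkHub_integral`) and Harris' inequality for an
increasing and a decreasing event. [cite: VandenbergHaggstromKahn2005, Thm. 1.5 (p. 7)] -/
theorem stub_attachSetRescueNegCorr :
    ∀ (n : ℕ) (w : Sym2 (Fin n) → unitInterval) (A : Finset (Fin n)) (S : Set (Fin n)) (o b x : Fin n),
      (prodBernoulli w).real ({ω | ∃ a ∈ A, ω ∈ openConnIn (insert a S) o a} ∩
          ({ω | ∀ a ∈ A, ω ∉ openConn a b} ∩ openConn x b)) ≤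
        (prodBernoulli w).real {ω | ∃ a ∈ A, ω ∈ openConnIn (insert a S) o a} *
          (prodBernoulli w).real ({ω | ∀ a ∈ A, ω ∉ openConn a b} ∩ openConn x b) := by
  intro n w A S o b x
  have hm : ∀ E : Set (BondConfig (Fin n)), MeasurableSet E := fun _ => MeasurableSet.of_discrete
  -- `h ⊆ D`: if `x ↔ a` and `x ↔ b` then `a ↔ b`
  have hfD : ({ω | ∀ a ∈ A, ω ∉ openConn a b} ∩ openConn x b : Set (BondConfig (Fin n))) ⊆
      {ω | ∀ a ∈ A, ω ∉ openConn x a} := by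
    rintro ω ⟨h1, h2⟩ a ha h3
    exact h1 a ha (SimpleGraph.Reachable.trans (SimpleGraph.Reachable.symm h3) h2)
  -- BHK Thm. 1.5 on the hub-augmented graph for `(s, t) = (some x, none)`, pulled back to `μ`
  have key := attachRescueNegCorr_twoCluster (V := Option (Fin n)) hubW⟦A, w⟧ (some x) none (some b)
    {ω : BondConfig (Option (Fin n)) | ∃ a ∈ A, s(none, some a) ∈ ω ∧
      ω ∈ openConnIn (some '' insert a S) (some o) (some a)}
    (attachSet_hubEvent_mono_openEdgeCluster A S o) (Option.some_ne_none x)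
  rw [attachSet_measureReal_hub A w (attachSet_pull_h (A := A) (x := x) (b := b)),
    attachSet_measureReal_hub A w (attachSet_pull_DQ (A := A) (S := S) (o := o) (x := x)),
    attachSet_measureReal_hub A w (attachSet_pull_D (A := A) (x := x)),
    attachSet_measureReal_hub A w (attachSet_pull_hQ (A := A) (S := S) (o := o) (x := x) (b := b))]
    at key
  -- Harris for `F_A` (increasing) and `D` (decreasing)
  have hFup : IsUpperSet ({ω | ∃ a ∈ A, ω ∈ openConnIn (insert a S) o a} : Set (BondConfig (Fin n))) := by
    rintro ω ω' hle ⟨a, ha, hω⟩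
    exact ⟨a, ha, isUpperSet_openConnIn (insert a S) o a hle hω⟩
  have hDlow : IsLowerSet ({ω | ∀ a ∈ A, ω ∉ openConn x a} : Set (BondConfig (Fin n))) :=
    fun ω ω' hle hω a ha h => hω a ha (isUpperSet_openConn x a hle h)
  have hharris := prodBernoulli_harris_upper_lower w hFup hDlow (hm _) (hm _)
  -- notation and bookkeeping, as in `stub_attachRescueNegCorr`
  set μ := prodBernoulli w with hμ
  set F : Set (BondConfig (Fin n)) := {ω | ∃ a ∈ A, ω ∈ openConnIn (insert a S) o a} with hF
  set f : Set (BondConfig (Fin n)) := {ω | ∀ a ∈ A, ω ∉ openConn a b} ∩ openConn x b with hf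
  set D : Set (BondConfig (Fin n)) := {ω | ∀ a ∈ A, ω ∉ openConn x a} with hD
  have hsplit : ∀ X Y : Set (BondConfig (Fin n)), μ.real (X ∩ Yᶜ) = μ.real X - μ.real (Y ∩ X) := by
    intro X Y
    have h := measureReal_inter_add_sdiff (μ := μ) (s := X) (t := Y) (hm Y)
    rw [Set.sdiff_eq_compl_inter, Set.inter_comm Yᶜ X, Set.inter_comm X Y] at h
    linarith
  rw [hsplit D F, hsplit f F] at key
  -- `key : μ f * (μ D - μ (F ∩ D)) ≤ μ D * (μ f - μ (F ∩ f))`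
  have hfle : μ.real f ≤ μ.real D := measureReal_mono hfD
  have hZf : μ.real (F ∩ f) ≤ μ.real f := measureReal_mono Set.inter_subset_right
  rcases (measureReal_nonneg (μ := μ) (s := D)).eq_or_lt with hD0 | hDpos
  · calc μ.real (F ∩ f) ≤ μ.real f := hZf
      _ ≤ μ.real D := hfle
      _ = 0 := hD0.symm
      _ ≤ μ.real F * μ.real f := mul_nonneg measureReal_nonneg measureReal_nonneg
  · have h2 : μ.real f * μ.real (F ∩ D) ≤ μ.real f * (μ.real F * μ.real D) :=
      mul_le_mul_of_nonneg_left hharris measureReal_nonneg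
    have h1 : μ.real D * μ.real (F ∩ f) ≤ μ.real D * (μ.real F * μ.real f) := by
      nlinarith [key, h2]
    exact le_of_mul_le_mul_left h1 hDpos

end AttachSetRescueNegCorr

end Summit.CriticalPhenomena.PercolationContinuityZ3.Theorems
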